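import Summits.AtomisticToContinuum.FouriersLaw.Theorems.HonestZwanzigRobinCoercivitySymbolNonnegSections

/-!
# `HonestZwanzig.RobinCoercivity`, line `limit-operator-memory-form`: symbol lower bound from mean-zero coercive
Toeplitz sections (part 1 of 2, pure analysis)

Support file for the crux `stmt-AtomisticToContinuum-12695` (`RobinCoercivity` of route `HonestZwanzig`, sub-problem
`FouriersLaw`), line `limit-operator-memory-form`, registered necessity link `symbol_ge_of_robinCoercivity` (part 2,
`…SymbolLowerBound`): the crux implies a uniform positive lower bound on the cosine symbol of every bulk Toeplitz
limit of the block memory matrix. This file is the Toeplitz/Fejér half, with no project definitions: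

* `sections_coercive_of_meanZero` — if every finite section `T_M(K) = (K(i−j))_{i,j<M}` of the Toeplitz matrix of a
  summable `K : ℤ → ℝ` satisfies `vᵀT_M(K)v ≥ c|v|²` for the vectors `v` with `Σ_i v_i = 0`, then it satisfies it for
  ALL vectors: test the width-`(2M+D)` section with the mean-zero dipole `(u, 0_D, −u)`; the cross terms are a fixed
  finite combination of the entries `K(· ± (M+D))`, which tend to `0` as `D → ∞` (`Summable.tendsto_cofinite_zero`).
* `symbol_ge_of_sections_coercive` — full coercivity of all sections gives `Σ'_z K(z)cos(zθ) ≥ c` at every `θ`: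
  the cosine and sine profiles of wavenumber `θ` turn `Σ_{i,j<M} K(i−j)cos((i−j)θ) ≥ cM` (Fejér sums), and the Cesàro
  means of the symmetric partial sums converge to the symbol (`sum_range_sum_range_sub`,
  `tendsto_symmetric_partial_sum` of part `…SymbolNonnegSections`).
* `symbol_ge_of_meanZero_coercive` — the two combined (the registered headline of this file).
-/

noncomputable section

open Finset Filter Topology

namespace Summit.AtomisticToContinuum.FouriersLaw.Theorems.HonestZwanzig.Robin

variable {K : ℤ → ℝ}

/-! ### Entries of a summable kernel far from the diagonal are small -/

/-- A summable kernel tends to zero along the translates `D ↦ K(n + D)`. -/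
theorem tendsto_kernel_add_nat (hK : Summable K) (n : ℤ) :
    Tendsto (fun D : ℕ => K (n + D)) atTop (𝓝 0) := by
  have hinj : Function.Injective (fun D : ℕ => n + (D : ℤ)) := fun a b h => by
    simpa using h
  have h2 := hK.tendsto_cofinite_zero.comp hinj.tendsto_cofinite
  rwa [Nat.cofinite_eq_atTop] at h2

/-- A summable kernel tends to zero along the translates `D ↦ K(n − D)`. -/
theorem tendsto_kernel_sub_nat (hK : Summable K) (n : ℤ) :
    Tendsto (fun D : ℕ => K (n - D)) atTop (𝓝 0) := by
  have hinj : Function.Injective (fun D : ℕ => n - (D : ℤ)) := fun a b h => by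
    simpa using h
  have h2 := hK.tendsto_cofinite_zero.comp hinj.tendsto_cofinite
  rwa [Nat.cofinite_eq_atTop] at h2

/-! ### The dipole test vector `(u, 0_D, −u)` -/

/-- Sums against the dipole vector `v = (u_0,…,u_{M−1}, 0,…,0 (D times), −u_0,…,−u_{M−1})` of width `M + D + M`. -/
theorem dipole_sum (M D : ℕ) (u v : ℕ → ℝ)
    (hv : ∀ k, v k = if k < M then u k else if M + D ≤ k then -u (k - (M + D)) else 0) (g : ℕ → ℝ) :
    ∑ k ∈ range (M + D + M), v k * g k = ∑ k ∈ range M, u k * (g k - g (M + D + k)) := by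
  rw [Finset.sum_range_add, Finset.sum_range_add]
  have h1 : ∑ k ∈ range M, v k * g k = ∑ k ∈ range M, u k * g k :=
    Finset.sum_congr rfl fun k hk => by rw [hv, if_pos (Finset.mem_range.1 hk)]
  have h2 : ∑ k ∈ range D, v (M + k) * g (M + k) = 0 :=
    Finset.sum_eq_zero fun k hk => by
      have hk' := Finset.mem_range.1 hk
      rw [hv, if_neg (by omega), if_neg (by omega), zero_mul]
  have h3 : ∑ k ∈ range M, v (M + D + k) * g (M + D + k) = -∑ k ∈ range M, u k * g (M + D + k) := by
    rw [← Finset.sum_neg_distrib]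
    refine Finset.sum_congr rfl fun k _ => ?_
    rw [hv, if_neg (by omega), if_pos (by omega), Nat.add_sub_cancel_left]
    ring
  rw [h1, h2, h3, add_zero, ← sub_eq_add_neg, ← Finset.sum_sub_distrib]
  exact Finset.sum_congr rfl fun k _ => by ring

/-- **Mean-zero coercivity of all Toeplitz sections is full coercivity.** If `vᵀT_M(K)v ≥ c|v|²` for every width `M`
and every `v` with `Σ_{i<M} v_i = 0`, then `uᵀT_M(K)u ≥ c|u|²` for every `u` (summable `K : ℤ → ℝ`). -/
theorem sections_coercive_of_meanZero (hK : Summable K) (c : ℝ)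
    (h : ∀ (M : ℕ) (v : ℕ → ℝ), ∑ i ∈ range M, v i = 0 →
      c * ∑ i ∈ range M, v i ^ 2 ≤ ∑ i ∈ range M, ∑ j ∈ range M, v i * K ((i : ℤ) - j) * v j)
    (M : ℕ) (u : ℕ → ℝ) :
    c * ∑ i ∈ range M, u i ^ 2 ≤ ∑ i ∈ range M, ∑ j ∈ range M, u i * K ((i : ℤ) - j) * u j := by
  -- the dipole test at separation `D`
  have hD : ∀ D : ℕ, 2 * (c * ∑ i ∈ range M, u i ^ 2) ≤
      ∑ k ∈ range M, ∑ l ∈ range M, u k * u l *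
        (2 * K ((k : ℤ) - l) - K ((k : ℤ) - ((M + D + l : ℕ) : ℤ)) - K (((M + D + k : ℕ) : ℤ) - l)) := by
    intro D
    set v : ℕ → ℝ := fun k => if k < M then u k else if M + D ≤ k then -u (k - (M + D)) else 0 with hv_def
    have hv : ∀ k, v k = if k < M then u k else if M + D ≤ k then -u (k - (M + D)) else 0 := fun k => rfl
    have hvk : ∀ k, k < M → v k = u k := fun k hk => by rw [hv]; exact if_pos hk
    have hvs : ∀ k, v (M + D + k) = -u k := fun k => by
      rw [hv, if_neg (by omega), if_pos (by omega), Nat.add_sub_cancel_left]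
    -- mean zero
    have h0 : ∑ k ∈ range (M + D + M), v k = 0 := by
      have := dipole_sum M D u v hv (fun _ => 1)
      simp only [mul_one, sub_self, mul_zero, Finset.sum_const_zero] at this
      exact this
    -- norm
    have h1 : ∑ k ∈ range (M + D + M), v k ^ 2 = 2 * ∑ k ∈ range M, u k ^ 2 := by
      rw [show ∑ k ∈ range (M + D + M), v k ^ 2 = ∑ k ∈ range (M + D + M), v k * v k from
        Finset.sum_congr rfl fun k _ => pow_two (v k), dipole_sum M D u v hv v, Finset.mul_sum]
      refine Finset.sum_congr rfl fun k hk => ?_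
      rw [hvk k (Finset.mem_range.1 hk), hvs k]
      ring
    -- quadratic form
    have h2 : ∑ k ∈ range (M + D + M), ∑ l ∈ range (M + D + M), v k * K ((k : ℤ) - l) * v l =
        ∑ k ∈ range M, ∑ l ∈ range M, u k * u l *
          (2 * K ((k : ℤ) - l) - K ((k : ℤ) - ((M + D + l : ℕ) : ℤ)) - K (((M + D + k : ℕ) : ℤ) - l)) := by
      have inner : ∀ k : ℕ, ∑ l ∈ range (M + D + M), v k * K ((k : ℤ) - l) * v l =
          v k * ∑ l ∈ range M, u l * (K ((k : ℤ) - l) - K ((k : ℤ) - ((M + D + l : ℕ) : ℤ))) := by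
        intro k
        rw [show ∑ l ∈ range (M + D + M), v k * K ((k : ℤ) - l) * v l =
          ∑ l ∈ range (M + D + M), v l * (v k * K ((k : ℤ) - l)) from
          Finset.sum_congr rfl fun l _ => by ring, dipole_sum M D u v hv (fun l => v k * K ((k : ℤ) - l)),
          Finset.mul_sum]
        exact Finset.sum_congr rfl fun l _ => by ring
      rw [Finset.sum_congr rfl fun k _ => inner k,
        dipole_sum M D u v hv
          (fun k => ∑ l ∈ range M, u l * (K ((k : ℤ) - l) - K ((k : ℤ) - ((M + D + l : ℕ) : ℤ))))]
      refine Finset.sum_congr rfl fun k _ => ?_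
      rw [← Finset.sum_sub_distrib, Finset.mul_sum]
      refine Finset.sum_congr rfl fun l _ => ?_
      have e4 : K (((M + D + k : ℕ) : ℤ) - ((M + D + l : ℕ) : ℤ)) = K ((k : ℤ) - l) := by
        congr 1
        push_cast
        ring
      rw [e4]
      ring
    have := h (M + D + M) v h0
    rw [h1, h2] at this
    linarith
  -- the cross terms vanish as `D → ∞`
  have hlim : Tendsto (fun D : ℕ => ∑ k ∈ range M, ∑ l ∈ range M, u k * u l *
      (2 * K ((k : ℤ) - l) - K ((k : ℤ) - ((M + D + l : ℕ) : ℤ)) - K (((M + D + k : ℕ) : ℤ) - l))) atTop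
      (𝓝 (∑ k ∈ range M, ∑ l ∈ range M, u k * u l * (2 * K ((k : ℤ) - l) - 0 - 0))) := by
    refine tendsto_finsetSum _ fun k _ => tendsto_finsetSum _ fun l _ => ?_
    refine tendsto_const_nhds.mul ((tendsto_const_nhds.sub ?_).sub ?_)
    · refine (tendsto_kernel_sub_nat hK ((k : ℤ) - M - l)).congr fun D => ?_
      congr 1
      push_cast
      ring
    · refine (tendsto_kernel_add_nat hK ((M : ℤ) + k - l)).congr fun D => ?_
      congr 1
      push_cast
      ring
  have h2Q : ∑ k ∈ range M, ∑ l ∈ range M, u k * u l * (2 * K ((k : ℤ) - l) - 0 - 0) =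
      2 * ∑ i ∈ range M, ∑ j ∈ range M, u i * K ((i : ℤ) - j) * u j := by
    rw [Finset.mul_sum]
    refine Finset.sum_congr rfl fun k _ => ?_
    rw [Finset.mul_sum]
    exact Finset.sum_congr rfl fun l _ => by ring
  have key := ge_of_tendsto hlim (Eventually.of_forall hD)
  rw [h2Q] at key
  linarith

/-! ### Fejér: coercive sections bound the symbol from below -/

/-- If the `M × M` Toeplitz sections of a summable `a : ℤ → ℝ` summed against the all-ones matrix are `≥ cM`, then
`Σ'_z a(z) ≥ c` (the section sums are `M ×` the Cesàro means of the symmetric partial sums). -/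
theorem tsum_ge_of_sections (a : ℤ → ℝ) (ha : Summable a) (c : ℝ)
    (hsec : ∀ M : ℕ, c * M ≤ ∑ i ∈ range M, ∑ j ∈ range M, a ((i : ℤ) - j)) : c ≤ ∑' z, a z := by
  have hlim := (tendsto_symmetric_partial_sum a ha).cesaro
  refine ge_of_tendsto hlim ?_
  filter_upwards [eventually_ge_atTop 1] with M hM
  rw [← sum_range_sum_range_sub]
  have hMpos : (0 : ℝ) < M := by exact_mod_cast hM
  rw [le_inv_mul_iff₀ hMpos]
  linarith [hsec M]

/-- **Coercive Toeplitz sections bound the cosine symbol from below.** If `uᵀT_M(K)u ≥ c|u|²` for every width `M`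
and every `u`, then `Σ'_z K(z)cos(zθ) ≥ c` at every `θ` (summable `K : ℤ → ℝ`): the cosine and sine profiles of
wavenumber `θ` give the Fejér sums `Σ_{i,j<M} K(i−j)cos((i−j)θ) ≥ cM`, whose Cesàro normalisations converge to
the symbol. -/
theorem symbol_ge_of_sections_coercive (hK : Summable K) (c : ℝ)
    (h : ∀ (M : ℕ) (u : ℕ → ℝ),
      c * ∑ i ∈ range M, u i ^ 2 ≤ ∑ i ∈ range M, ∑ j ∈ range M, u i * K ((i : ℤ) - j) * u j)
    (θ : ℝ) : c ≤ ∑' z : ℤ, K z * Real.cos (z * θ) := by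
  have ha : Summable (fun z : ℤ => K z * Real.cos (z * θ)) :=
    Summable.of_norm_bounded hK.norm fun z => by
      rw [norm_mul]
      exact mul_le_of_le_one_right (norm_nonneg _) (by simpa using Real.abs_cos_le_one (z * θ))
  refine tsum_ge_of_sections (fun z : ℤ => K z * Real.cos (z * θ)) ha c fun M => ?_
  show c * M ≤ ∑ i ∈ range M, ∑ j ∈ range M, K ((i : ℤ) - j) * Real.cos ((((i : ℤ) - j : ℤ) : ℝ) * θ)
  have hc := h M (fun i => Real.cos (i * θ))
  have hs := h M (fun i => Real.sin (i * θ))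
  have hsum : (∑ i ∈ range M, ∑ j ∈ range M, Real.cos (i * θ) * K ((i : ℤ) - j) * Real.cos (j * θ)) +
      ∑ i ∈ range M, ∑ j ∈ range M, Real.sin (i * θ) * K ((i : ℤ) - j) * Real.sin (j * θ) =
      ∑ i ∈ range M, ∑ j ∈ range M, K ((i : ℤ) - j) * Real.cos ((((i : ℤ) - j : ℤ) : ℝ) * θ) := by
    rw [← Finset.sum_add_distrib]
    refine Finset.sum_congr rfl fun i _ => ?_
    rw [← Finset.sum_add_distrib]
    refine Finset.sum_congr rfl fun j _ => ?_
    have e1 : (((i : ℤ) - j : ℤ) : ℝ) * θ = i * θ - j * θ := by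
      push_cast
      ring
    rw [e1, Real.cos_sub]
    ring
  have hnorm : (∑ i ∈ range M, Real.cos (i * θ) ^ 2) + ∑ i ∈ range M, Real.sin (i * θ) ^ 2 = M := by
    rw [← Finset.sum_add_distrib, Finset.sum_congr rfl fun (i : ℕ) _ => Real.cos_sq_add_sin_sq ((i : ℝ) * θ)]
    simp
  have : c * M = c * (∑ i ∈ range M, Real.cos (i * θ) ^ 2) + c * ∑ i ∈ range M, Real.sin (i * θ) ^ 2 := by
    rw [← mul_add, hnorm]
  linarith

/-- **Symbol lower bound from mean-zero coercive sections** (parts combined): if every finite Toeplitz section of a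
summable `K : ℤ → ℝ` satisfies `vᵀT_M(K)v ≥ c|v|²` on the vectors with `Σ_i v_i = 0`, then
`Σ'_z K(z)cos(zθ) ≥ c` at every `θ`. -/
theorem symbol_ge_of_meanZero_coercive (K : ℤ → ℝ) (hK : Summable K) (c : ℝ)
    (h : ∀ (M : ℕ) (v : ℕ → ℝ), ∑ i ∈ Finset.range M, v i = 0 →
      c * ∑ i ∈ Finset.range M, v i ^ 2 ≤
        ∑ i ∈ Finset.range M, ∑ j ∈ Finset.range M, v i * K ((i : ℤ) - j) * v j)
    (θ : ℝ) : c ≤ ∑' z : ℤ, K z * Real.cos (z * θ) :=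
  symbol_ge_of_sections_coercive hK c (sections_coercive_of_meanZero hK c h) θ

end Summit.AtomisticToContinuum.FouriersLaw.Theorems.HonestZwanzig.Robin

end
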